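import Mathlib.LinearAlgebra.Matrix.SpecialLinearGroup
import Mathlib.LinearAlgebra.Matrix.GeneralLinearGroup.FinTwo
import Mathlib.Algebra.Field.ZMod
import HarnessLib

/-!
# Subgroups of `GL₂` containing the upper unipotent group and one non-upper-triangular element
# contain `SL₂` ([GenEll] Lemma 3.1 (iii))

S. Mochizuki, *Arithmetic elliptic curves in general position*, Math. J. Okayama Univ. **52** (2010),
Lemma 3.1 (iii), p. 14 of the RIMS manuscript [cite: MochizukiGenEll2010, Lem 3.1 (iii) p.14]:

> (iii) Let `H ⊆ GL₂(𝔽_l)` be a subgroup that contains the matrix `α = (1 1; 0 1)`, as well as at least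
> one matrix that is not upper triangular. Then `SL₂(𝔽_l) ⊆ H`.

(The printed hypothesis "`l ≥ 5` prime" of Lemma 3.1 is not needed for (iii); we prove it for every prime
`l`.)  The printed proof counts `l`-Sylow subgroups; we give the equivalent direct argument with the two
root groups: over ANY field `F`, a subgroup `H ≤ GL₂(F)` containing every upper transvection
`U(t) = (1 t; 0 1)` and one element `g = (a b; c d)` with `c ≠ 0` contains every lower transvection
`L(u) = (1 0; u 1)`, because with `k = U(−a/c)` and `s = u(bc − ad)/c²` one has the matrix identity
`(k g)·U(s) = L(u)·(k g)` (`toGL_transvection_one_zero_mem`); upper and lower transvections generate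
`SL₂(F)` (Mathlib `Matrix.SL2.transvection_induction`), so `SL₂(F) ≤ H` (`toGL_mem_of_transvections_mem`).
Over `𝔽_l = ZMod l` every upper transvection is a power of `α = U(1)`, which gives (iii) as printed
(`toGL_mem_of_upperRightHom_one_mem`, stated with Mathlib's `GeneralLinearGroup.upperRightHom 1 = α`, and
`toGL_mem_of_transvection_one_mem`, stated with Mathlib's `SpecialLinearGroup.transvection`).

Everything here is proved from Mathlib; no named fact is introduced.  This is classical finite group
theory (Dickson); it is recorded under [GenEll] because that is the form consumed by [GenEll] Thm. 3.8 /
[IUTchIV] Cor. 2.2.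
-/

namespace Literature.GroupTheory.SpecificGroups

open Matrix MatrixGroups Matrix.SpecialLinearGroup

section Field

variable {F : Type*} [Field F]

/-- The upper transvection `U(t)` of `SL₂(F)` as a matrix: `(1 t; 0 1)` — the matrix `α` of [GenEll]
Lemma 3.1 for `t = 1`. [cite: MochizukiGenEll2010, Lem 3.1 (iii) p.14] -/
theorem coe_transvection_zero_one (t : F) :
    ((SpecialLinearGroup.transvection (zero_ne_one : (0 : Fin 2) ≠ 1) t : SL(2, F)) :
      Matrix (Fin 2) (Fin 2) F) = !![1, t; 0, 1] := by
  rw [SpecialLinearGroup.transvection_coe]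
  ext i j
  fin_cases i <;> fin_cases j <;> simp

/-- The lower transvection `L(t)` of `SL₂(F)` as a matrix: `(1 0; t 1)` — the matrix `β` of [GenEll]
Lemma 3.1 (i) for `t = 1`. [cite: MochizukiGenEll2010, Lem 3.1 (i) p.14] -/
theorem coe_transvection_one_zero (t : F) :
    ((SpecialLinearGroup.transvection (one_ne_zero : (1 : Fin 2) ≠ 0) t : SL(2, F)) :
      Matrix (Fin 2) (Fin 2) F) = !![1, 0; t, 1] := by
  rw [SpecialLinearGroup.transvection_coe]
  ext i j
  fin_cases i <;> fin_cases j <;> simp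

/-- Mathlib's `upperRightHom t = (1 t; 0 1) ∈ GL₂` is the image of the upper transvection `U(t) ∈ SL₂`
(two spellings of the `α` of [GenEll] Lemma 3.1). [cite: MochizukiGenEll2010, Lem 3.1 (iii) p.14] -/
theorem toGL_transvection_zero_one (t : F) :
    toGL (SpecialLinearGroup.transvection (zero_ne_one : (0 : Fin 2) ≠ 1) t) =
      GeneralLinearGroup.upperRightHom t := by
  apply Matrix.GeneralLinearGroup.ext
  intro i j
  rw [coe_GL_coe_matrix, coe_transvection_zero_one, GeneralLinearGroup.upperRightHom_apply]

/-- **The two root groups.** If a subgroup `H ≤ GL₂(F)` (`F` any field) contains every upper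
transvection `U(t) = (1 t; 0 1)` and an element `g = (a b; c d)` with `c ≠ 0`, then it contains every
lower transvection `L(u) = (1 0; u 1)`: with `k = U(−a/c)`, `s = u·(bc − ad)/c²` one has
`(k·g)·U(s) = L(u)·(k·g)`, i.e. `L(u) = (k g) U(s) (k g)⁻¹ ∈ H` (the root-group form of the Sylow
count in the printed proof of [GenEll] Lemma 3.1 (iii)). [cite: MochizukiGenEll2010, Lem 3.1 (iii) p.14] -/
theorem toGL_transvection_one_zero_mem (H : Subgroup (GL (Fin 2) F))
    (hU : ∀ t : F, toGL (SpecialLinearGroup.transvection (zero_ne_one : (0 : Fin 2) ≠ 1) t) ∈ H)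
    {g : GL (Fin 2) F} (hg : g ∈ H) (hc : (g : Matrix (Fin 2) (Fin 2) F) 1 0 ≠ 0) (u : F) :
    toGL (SpecialLinearGroup.transvection (one_ne_zero : (1 : Fin 2) ≠ 0) u) ∈ H := by
  set a : F := (g : Matrix (Fin 2) (Fin 2) F) 0 0 with ha
  set b : F := (g : Matrix (Fin 2) (Fin 2) F) 0 1 with hb
  set c : F := (g : Matrix (Fin 2) (Fin 2) F) 1 0 with hc'
  set d : F := (g : Matrix (Fin 2) (Fin 2) F) 1 1 with hd
  have hgm : (g : Matrix (Fin 2) (Fin 2) F) = !![a, b; c, d] := by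
    rw [ha, hb, hc', hd]; exact Matrix.eta_fin_two _
  set k : GL (Fin 2) F :=
    toGL (SpecialLinearGroup.transvection (zero_ne_one : (0 : Fin 2) ≠ 1) (-(a / c))) with hk
  set s : F := u * (b * c - a * d) / c ^ 2 with hs
  have key : (k * g) * toGL (SpecialLinearGroup.transvection (zero_ne_one : (0 : Fin 2) ≠ 1) s) =
      toGL (SpecialLinearGroup.transvection (one_ne_zero : (1 : Fin 2) ≠ 0) u) * (k * g) := by
    apply Matrix.GeneralLinearGroup.ext
    intro i j
    simp only [Matrix.GeneralLinearGroup.coe_mul, hk, coe_GL_coe_matrix, coe_transvection_zero_one,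
      coe_transvection_one_zero, hgm]
    have h1 : a + -(a / c) * c = 0 := by field_simp; ring
    have h2 : (a + -(a / c) * c) * s + (b + -(a / c) * d) = b + -(a / c) * d := by
      rw [h1]; ring
    have h3 : u * (a + -(a / c) * c) + c = c := by rw [h1]; ring
    have h4 : c * s + d = u * (b + -(a / c) * d) + d := by rw [hs]; field_simp; ring
    fin_cases i <;> fin_cases j <;>
      simp only [Matrix.mul_apply, Fin.sum_univ_two, Fin.isValue, Matrix.of_apply, Matrix.cons_val',
        Matrix.cons_val_zero, Matrix.cons_val_one, Matrix.empty_val', Matrix.cons_val_fin_one,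
        Fin.zero_eta, Fin.mk_one] <;>
      first | ring1 | linear_combination h2 | linear_combination (-1 : F) * h3 | linear_combination h4

  have hconj : toGL (SpecialLinearGroup.transvection (one_ne_zero : (1 : Fin 2) ≠ 0) u) =
      (k * g) * toGL (SpecialLinearGroup.transvection (zero_ne_one : (0 : Fin 2) ≠ 1) s) * (k * g)⁻¹ := by
    rw [key, mul_inv_cancel_right]
  rw [hconj]
  exact H.mul_mem (H.mul_mem (H.mul_mem (hU _) hg) (hU s)) (H.inv_mem (H.mul_mem (hU _) hg))

/-- Upper and lower transvections generate `SL₂(F)`: a subgroup of `GL₂(F)` containing all `U(t)` and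
all `L(t)` contains (the image of) `SL₂(F)` (Mathlib `Matrix.SL2.transvection_induction`; this is
[GenEll] Lemma 3.1 (i) "`α`, `β` generate `SL₂(𝔽_l)`" in the form valid over any field).
[cite: MochizukiGenEll2010, Lem 3.1 (i) p.14] -/
theorem toGL_mem_of_transvections_mem (H : Subgroup (GL (Fin 2) F))
    (hU : ∀ t : F, toGL (SpecialLinearGroup.transvection (zero_ne_one : (0 : Fin 2) ≠ 1) t) ∈ H)
    (hL : ∀ t : F, toGL (SpecialLinearGroup.transvection (one_ne_zero : (1 : Fin 2) ≠ 0) t) ∈ H)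
    (x : SL(2, F)) : toGL x ∈ H := by
  induction x using Matrix.SL2.transvection_induction with
  | htransvec i j h t =>
    fin_cases i <;> fin_cases j
    · exact absurd rfl h
    · exact hU t
    · exact hL t
    · exact absurd rfl h
  | hmul A B hA hB => rw [map_mul]; exact H.mul_mem hA hB

/-- **[GenEll] Lemma 3.1 (iii), over any field, root-group form**: a subgroup `H ≤ GL₂(F)` containing
every upper transvection `U(t)` and some `g ∈ H` with lower-left entry `≠ 0` (i.e. not upper triangular)
contains `SL₂(F)`. [cite: MochizukiGenEll2010, Lem 3.1 (iii) p.14] -/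
theorem toGL_mem_of_upper_transvections_mem (H : Subgroup (GL (Fin 2) F))
    (hU : ∀ t : F, toGL (SpecialLinearGroup.transvection (zero_ne_one : (0 : Fin 2) ≠ 1) t) ∈ H)
    {g : GL (Fin 2) F} (hg : g ∈ H) (hc : (g : Matrix (Fin 2) (Fin 2) F) 1 0 ≠ 0) (x : SL(2, F)) :
    toGL x ∈ H :=
  toGL_mem_of_transvections_mem H hU (toGL_transvection_one_zero_mem H hU hg hc) x

end Field

section PrimeField

variable {l : ℕ} [Fact l.Prime]

/-- Over `𝔽_l`, every upper transvection `U(t)` is a power of `α = U(1)`; hence a subgroup containing `α`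
contains all of them (the remark "`α^λ` makes sense" in the printed proof of [GenEll] Lemma 3.1 (i)).
[cite: MochizukiGenEll2010, Lem 3.1 (i) p.14] -/
theorem toGL_transvection_zero_one_mem_of_one_mem (H : Subgroup (GL (Fin 2) (ZMod l)))
    (hα : toGL (SpecialLinearGroup.transvection (zero_ne_one : (0 : Fin 2) ≠ 1) (1 : ZMod l)) ∈ H)
    (t : ZMod l) :
    toGL (SpecialLinearGroup.transvection (zero_ne_one : (0 : Fin 2) ≠ 1) t) ∈ H := by
  have hn : ∀ n : ℕ,
      toGL (SpecialLinearGroup.transvection (zero_ne_one : (0 : Fin 2) ≠ 1) (n : ZMod l)) ∈ H := by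
    intro n
    induction n with
    | zero => simp
    | succ n ih =>
      rw [Nat.cast_succ, SpecialLinearGroup.transvection_add, map_mul]
      exact H.mul_mem ih hα
  simpa [ZMod.natCast_zmod_val] using hn t.val

/-- **[GenEll] Lemma 3.1 (iii)** (p. 14), as printed, with `α` the Mathlib transvection `U(1) ∈ SL₂(𝔽_l)`:
let `H ⊆ GL₂(𝔽_l)` be a subgroup containing `α = (1 1; 0 1)` and at least one matrix that is not upper
triangular (lower-left entry `≠ 0`); then `SL₂(𝔽_l) ⊆ H`. Holds for every prime `l`.
[cite: MochizukiGenEll2010, Lem 3.1 (iii) p.14] -/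
theorem toGL_mem_of_transvection_one_mem (H : Subgroup (GL (Fin 2) (ZMod l)))
    (hα : toGL (SpecialLinearGroup.transvection (zero_ne_one : (0 : Fin 2) ≠ 1) (1 : ZMod l)) ∈ H)
    {g : GL (Fin 2) (ZMod l)} (hg : g ∈ H) (hc : (g : Matrix (Fin 2) (Fin 2) (ZMod l)) 1 0 ≠ 0)
    (x : SL(2, ZMod l)) : toGL x ∈ H :=
  toGL_mem_of_upper_transvections_mem H (toGL_transvection_zero_one_mem_of_one_mem H hα) hg hc x

/-- **[GenEll] Lemma 3.1 (iii)** (p. 14), as printed, with `α = upperRightHom 1 = (1 1; 0 1) ∈ GL₂(𝔽_l)`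
(Mathlib `Matrix.GeneralLinearGroup.upperRightHom`): a subgroup `H ⊆ GL₂(𝔽_l)` containing `α` and a
matrix that is not upper triangular contains `SL₂(𝔽_l)`, i.e. the range of `SL₂(𝔽_l) → GL₂(𝔽_l)` lies in
`H`. [cite: MochizukiGenEll2010, Lem 3.1 (iii) p.14] -/
theorem range_toGL_le_of_upperRightHom_one_mem (H : Subgroup (GL (Fin 2) (ZMod l)))
    (hα : GeneralLinearGroup.upperRightHom (1 : ZMod l) ∈ H)
    (hβ : ∃ g ∈ H, (g : Matrix (Fin 2) (Fin 2) (ZMod l)) 1 0 ≠ 0) :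
    (toGL : SL(2, ZMod l) →* GL (Fin 2) (ZMod l)).range ≤ H := by
  rintro _ ⟨x, rfl⟩
  obtain ⟨g, hg, hc⟩ := hβ
  rw [← toGL_transvection_zero_one] at hα
  exact toGL_mem_of_transvection_one_mem H hα hg hc x

end PrimeField

end Literature.GroupTheory.SpecificGroups
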